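import Summits.HubbardSuperconductivity.HubbardSuperconductivity.Theorems.AnisotropyChordTransferFibre3FinX5Tables
import Summits.HubbardSuperconductivity.HubbardSuperconductivity.Theorems.AnisotropyChordTransferFibre3FinXCCert

/-!
# Route `AnisotropyChord` / H0 rotor rung: FIN per-`L` GM₃ (X5) — g5's row-C object enclosures for ARBITRARY profile / gradient tables

Soundness layer 3 of `…FinX5Eval`: the table-specific lemmas of `…FinXCSound` / `…FinXCCert` (`mem_gradAt`, `mem_xcPsi`, `mem_xcC0x`,
`mem_xcRowSum`, `xcObj_sound`, all stated on `fTab4` / `gTab4`) restated for ANY tables `ft`, `gx` that enclose the ground profile and its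
`x̂`-gradient (`TabEncl L f ft`, `∀ r, D_{x̂} f(r) ∈ gx(r)`): ★ `mem_gradAtG`, ★ `mem_xcPsiG`, ★ `mem_xcC0xG`, ★ `mem_xcRowSumG`, and
★ `xcObjG_sound` — the row-C objects of `…FinX3Eval.xcObjT L S tb ft gx` enclose reals `Chi ≥ cs2`, `Nhi ≥ ‖C0′‖²` and `η`
(proofs verbatim from g5; the tables `fTabA` / `gTabA` of the X5 point wedges qualify by `…FinX5Tables`).
Prover seat `hubbard-h0-rotor-p3` g8; helper for piece A = stmt-HubbardSuperconductivity-23918 of rung 19089 (`--supports`, helper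
class).  WHAT THIS IS NOT: nothing here proves superconductivity in the Hubbard model (rotor TARGET as worded stays FALSE, g15 verdict);
evaluator soundness for the FIN certificates of ONE conditional reduction.  Tree imports only; no sorry, no new axioms.
-/

set_option linter.dupNamespace false
set_option autoImplicit false

namespace Summit.HubbardSuperconductivity.HubbardSuperconductivity.Theorems.AnisotropyChord.Transfer.Fibre3

namespace FinXB

open scoped BigOperators
open Finset Hole2 FinCell

variable {L : ℕ} [NeZero L]

/-- a gradient-table hypothesis: `gx` encloses `D_{x̂} f` at every site. -/
def GradEncl (L : ℕ) [NeZero L] (f : Tor L → ℝ) (gx : List (List Iv)) : Prop :=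
  ∀ r1 r2 : ℕ, r1 < L → r2 < L → mem (Dgrad L f (ex L) (np L r1 r2)) (getF gx r1 r2)

/-- ★ `D_e f` from any `x̂`-gradient table of the ground profile (swap symmetry), all four directions. [folklore] -/
theorem mem_gradAtG (hL : 5 ≤ L) {Δ lam2 : ℝ} (hΔ0 : 0 ≤ Δ) (hΔ1 : Δ < 1) {f : Tor L → ℝ} (hf : IsGroundTwoMagnon L Δ lam2 f)
    {gx : List (List Iv)} (hx : GradEncl L f gx) {j : ℕ} (hj : j < 4) {r1 r2 : ℕ} (h1 : r1 < L) (h2 : r2 < L) :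
    mem (Dgrad L f (eDir L j) (np L r1 r2)) (gradAt L gx j r1 r2) := by
  have hL0 : 0 < L := by omega
  have hfe : f = groundF L lam2 := ground_eq_explicit L (by omega) hΔ0 hΔ1 hf
  have hsw : ∀ r : Tor L, f (r.2, r.1) = f r := fun r => by rw [hfe]; exact groundF_swap lam2 r
  have hr1' : (r1 + 1) % L < L := Nat.mod_lt _ hL0
  have hr2' : (r2 + 1) % L < L := Nat.mod_lt _ hL0
  have hc1 : ((((r1 + 1) % L : ℕ)) : ZMod L) = ((r1 : ℕ) : ZMod L) + 1 := by
    rw [ZMod.natCast_mod]; push_cast; ring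
  have hc2 : ((((r2 + 1) % L : ℕ)) : ZMod L) = ((r2 : ℕ) : ZMod L) + 1 := by
    rw [ZMod.natCast_mod]; push_cast; ring
  unfold GradEncl np at hx
  unfold gradAt np
  interval_cases j
  · have e : eDir L 0 = ex L := rfl
    rw [e]; simpa using hx r1 r2 h1 h2
  · have e : eDir L 1 = -ex L := rfl
    rw [e, Dgrad_negx]
    have h := mem_ineg (hx _ _ hr1' h2)
    rw [hc1] at h
    simpa using h
  · have e : eDir L 2 = ey L := rfl
    rw [e, Dgrad_ey_swap hsw]
    simpa using hx r2 r1 h2 h1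
  · have e : eDir L 3 = -ey L := rfl
    rw [e, Dgrad_negy_swap hsw]
    have h := mem_ineg (hx _ _ hr2' h1)
    rw [hc2] at h
    simpa using h

/-- ★ `Ψ ∈ xcPsi gx` for the ground profile and any gradient table. [folklore] -/
theorem mem_xcPsiG (hL : 5 ≤ L) {Δ lam2 : ℝ} (hΔ0 : 0 ≤ Δ) (hΔ1 : Δ < 1) {f : Tor L → ℝ} (hf : IsGroundTwoMagnon L Δ lam2 f)
    {gx : List (List Iv)} (hx : GradEncl L f gx) :
    mem (PsiSum L Δ f) (xcPsi L gx) := by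
  classical
  have hL3 : 3 ≤ L := by omega
  unfold PsiSum xcPsi
  rw [nnList_sum_range]
  refine mem_psum _ _ 4 fun j hj => ?_
  rw [nnList_sum_range]
  refine mem_psum _ _ 4 fun j' hj' => mem_isqP ?_
  unfold psiCorr xcPsiPair
  rw [Finset.sum_filter, sum_tor_range]
  refine mem_psum _ _ L fun r1 h1 => mem_psum _ _ L fun r2 h2 => ?_
  have hreg := isRegN_iff (L := L) hL3 h1 h2
  unfold np at hreg
  by_cases hr : isRegN L r1 r2 = true
  · have hR := hreg.mp hr
    rw [if_pos hR]; simp only [hr, if_true]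
    obtain ⟨h0, hnn⟩ := hR
    have hds : ∀ {i : ℕ}, i < 4 → Dgrad L (sfun' L Δ f) (eDir L i) ((((r1 : ℕ) : ZMod L), ((r2 : ℕ) : ZMod L)))
        = -Dgrad L f (eDir L i) ((((r1 : ℕ) : ZMod L), ((r2 : ℕ) : ZMod L))) := by
      intro i hi
      have hne : ((((r1 : ℕ) : ZMod L), ((r2 : ℕ) : ZMod L)) : Tor L) - eDir L i ≠ 0 := by
        intro h
        rw [sub_eq_zero] at h
        rw [h, isNN_eDir i] at hnn
        exact Bool.noConfusion hnn
      unfold Dgrad sfun'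
      rw [if_neg h0, if_neg hne]; ring
    rw [hds hj, hds hj', neg_mul_neg]
    exact mem_imul (mem_gradAtG hL hΔ0 hΔ1 hf hx hj h1 h2) (mem_gradAtG hL hΔ0 hΔ1 hf hx hj' h1 h2)
  · have hR : ¬ IsReg L ((((r1 : ℕ) : ZMod L), ((r2 : ℕ) : ZMod L))) := fun h => hr (hreg.mpr h)
    rw [if_neg hR]; simp only [hr]; exact mem_zero

/-- ★ `C0(x̂, b) ∈ xcC0x ft gx` for `b ∉ {0, x̂}` (ground profile, any enclosing tables). [folklore] -/
theorem mem_xcC0xG (hL : 5 ≤ L) {Δ lam2 : ℝ} (hΔ0 : 0 ≤ Δ) (hΔ1 : Δ < 1) {f : Tor L → ℝ} (hf : IsGroundTwoMagnon L Δ lam2 f)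
    {ft gx : List (List Iv)} (hft : TabEncl L f ft) (hx : GradEncl L f gx)
    {b1 b2 : ℕ} (h1 : b1 < L) (h2 : b2 < L) (hb : notCore b1 b2 = true) :
    mem (C0fn L Δ lam2 f (ex L, np L b1 b2)) (xcC0x L ft gx b1 b2) := by
  have hL3 : 3 ≤ L := by omega
  have hL0 : 0 < L := by omega
  obtain ⟨hb0, hbx⟩ := (notCore_iff (L := L) hL3 h1 h2).mp hb
  have hex : ex L = np L 1 0 := (ex_eq (L := L) hL3).1
  have hexne : ex L ≠ 0 := by
    rw [hex, Ne, np_eq_zero (by omega) hL0]; simp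
  have hD' : InD L (ex L, np L b1 b2) = false := by
    unfold InD
    simp only [Bool.or_eq_false_iff, decide_eq_false_iff_not]
    exact ⟨⟨hexne, hb0⟩, fun h => hbx h.symm⟩
  rw [c0Explicit_holds L Δ lam2 f hf.1 _ hD', nnList_sum_range]
  have hc : np L b1 b2 - ex L = np L ((b1 + (L - 1)) % L) b2 := by
    rw [hex]; unfold np
    refine Prod.ext ?_ ?_
    · simp only [Prod.fst_sub, ZMod.natCast_mod]
      rw [Nat.cast_add, Nat.cast_sub (by omega : 1 ≤ L), ZMod.natCast_self]; push_cast; ring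
    · simp
  have hidx : (b1 + (L - 1)) % L < L := Nat.mod_lt _ hL0
  unfold xcC0x
  have hs := mem_psum (fun j => f (np L b1 b2 - ex L) * Dgrad L f (eDir L j) (ex L) * Dgrad L f (eDir L j) (np L b1 b2)
      + f (np L b1 b2) * Dgrad L f (-eDir L j) (ex L) * Dgrad L f (eDir L j) (np L b1 b2 - ex L)
      + f (ex L) * Dgrad L f (eDir L j) (np L b1 b2) * Dgrad L f (eDir L j) (np L b1 b2 - ex L)) _ 4 (by
    intro j hj
    rw [eDir_negDir j hj, hc, hex]
    have hg := fun {i : ℕ} (hi : i < 4) {x y : ℕ} (hx' : x < L) (hy : y < L) =>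
      mem_gradAtG (L := L) hL hΔ0 hΔ1 hf hx hi hx' hy
    unfold np
    exact mem_iadd (mem_iadd
      (mem_imul (mem_imul (hft _ _ hidx h2) (hg hj (by omega) hL0)) (hg hj h1 h2))
      (mem_imul (mem_imul (hft _ _ h1 h2) (hg (negDir_lt j) (by omega) hL0)) (hg hj hidx h2)))
      (mem_imul (mem_imul (hft _ _ (by omega) hL0) (hg hj h1 h2)) (hg hj hidx h2)))
  have h := mem_ineg (mem_idivn hs (by norm_num : (0 : ℤ) < 2))
  have e : ∀ x : ℝ, -(x / ((2 : ℤ) : ℝ)) = -(1 / 2) * x := by intro x; push_cast; ring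
  rw [e] at h
  simpa only [Prod.mk.eta] using h

/-- ★ `Σ_{b ∉ {0,x̂}} C0(x̂,b)² ∈ xcRowSum ft gx`. [folklore] -/
theorem mem_xcRowSumG (hL : 5 ≤ L) {Δ lam2 : ℝ} (hΔ0 : 0 ≤ Δ) (hΔ1 : Δ < 1) {f : Tor L → ℝ} (hf : IsGroundTwoMagnon L Δ lam2 f)
    {ft gx : List (List Iv)} (hft : TabEncl L f ft) (hx : GradEncl L f gx) :
    mem (∑ b ∈ ((Finset.univ : Finset (Tor L)).erase 0).erase (ex L), C0fn L Δ lam2 f (ex L, b) ^ 2) (xcRowSum L ft gx) := by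
  classical
  have hL3 : 3 ≤ L := by omega
  have hS : ((Finset.univ : Finset (Tor L)).erase 0).erase (ex L) = Finset.univ.filter (fun b : Tor L => b ≠ 0 ∧ b ≠ ex L) := by
    ext b; simp [and_comm]
  rw [hS, Finset.sum_filter, sum_tor_range]
  unfold xcRowSum
  refine mem_psum _ _ L fun b1 h1 => mem_psum _ _ L fun b2 h2 => ?_
  have hc := notCore_iff (L := L) hL3 h1 h2
  unfold np at hc
  by_cases hn : notCore b1 b2 = true
  · rw [if_pos (hc.mp hn)]; simp only [hn, if_true]
    exact mem_isqP (mem_xcC0xG hL hΔ0 hΔ1 hf hft hx h1 h2 hn)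
  · have : ¬ (((((b1 : ℕ) : ZMod L), ((b2 : ℕ) : ZMod L)) : Tor L) ≠ 0 ∧ ((((b1 : ℕ) : ZMod L), ((b2 : ℕ) : ZMod L)) : Tor L) ≠ ex L) :=
      fun h => hn (hc.mpr h)
    rw [if_neg this]; simp only [hn]; exact mem_zero

/-- ★ THE ROW-C OBJECTS OF `xcObjT L S tb ft gx` ARE SOUND for any enclosing tables: reals `Chi ≥ cs2`, `Nhi ≥ ‖C0′‖²` in
`C.chi`, `C.nhi`, and `η ∈ C.eta`. [folklore] -/
theorem xcObjG_sound {Δ lam2 : ℝ} {f : Tor L → ℝ} {la lb : ℤ} (H : CellHyp (L := L) Δ lam2 f la lb)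
    {ft gx : List (List Iv)} (hft : TabEncl L f ft) (hgx : GradEncl L f gx) (tb : ℤ × ℤ)
    (hMok : xcMok L ft (xcObjT L (xbScal L la lb (gresCellTab L (cosTab L) la lb)) tb ft gx).M = true) :
    ∃ Chi Nhi : ℝ, cs2 L f ≤ Chi ∧ nC0p L Δ f ≤ Nhi ∧ 0 ≤ Chi ∧ 0 ≤ Nhi ∧
      mem Chi (xcObjT L (xbScal L la lb (gresCellTab L (cosTab L) la lb)) tb ft gx).chi ∧
      mem Nhi (xcObjT L (xbScal L la lb (gresCellTab L (cosTab L) la lb)) tb ft gx).nhi ∧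
      mem (etaEff L lam2) (xcObjT L (xbScal L la lb (gresCellTab L (cosTab L) la lb)) tb ft gx).eta := by
  have hL := H.hL
  have hL3 : 3 ≤ L := H.hL3
  have hD := D_pos
  have hf := H.hf
  have hev := H.hev
  have hfe : f = groundF L lam2 := ground_eq_explicit L (by omega) H.hΔ0 H.hΔ1 hf
  have hsw : ∀ r : Tor L, f (r.2, r.1) = f r := fun r => by rw [hfe]; exact groundF_swap lam2 r
  have hmi : ∀ r : Tor L, f (-r.1, r.2) = f r := ground_mirror L (by omega) hf
  set S := xbScal L la lb (gresCellTab L (cosTab L) la lb) with hSdef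
  have mlam : mem lam2 S.lam := H.hS.1
  have meps : mem (eps1 L) S.eps1 := H.hS.2.2.2.2.2.2.2.2.2.2
  set Mz := xcM L ft with hMz
  set M : ℝ := (Mz : ℝ) / ((D : ℤ) : ℝ) with hM
  have hMabs : ∀ r : Tor L, |f r| ≤ M := abs_le_of_xcMok hft hMok
  have mM : mem M (ipt Mz) := mem_ipt Mz
  have mQ0 := mem_xcQ0 (L := L) hft
  have mRb := mem_xcRbar (L := L) hL3 (Δ := Δ) (f := f) hgx
  have mX := mem_xcX (L := L) hL3 (Δ := Δ) (f := f) hgx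
  have mPsi := mem_xcPsiG (L := L) hL H.hΔ0 H.hΔ1 hf hgx
  have mRS := mem_xcRowSumG (L := L) hL H.hΔ0 H.hΔ1 hf hft hgx
  have hL0 : 0 < L := by omega
  have mfnn : mem (f (K1 L)) (getF ft 1 0) := by
    have := hft 1 0 (by omega) hL0
    have e : K1 L = ((((1 : ℕ) : ZMod L)), (((0 : ℕ) : ZMod L))) := by unfold K1; simp
    rw [e]; exact this
  have mfnn2 := mem_isqP mfnn
  have mM2 := mem_imul mM mM
  rw [← sq] at mM2
  have mGam : mem (GammaM L Δ f M) (iscale 2 (imul (imul (ipt Mz) (ipt Mz)) (iadd (xcRbar L gx)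
      (iscale 2 (isqP (getF ft 1 0)))))) := by
    unfold GammaM
    have h := mem_iscale 2 (mem_imul mM2 (mem_iadd mRb (by have := mem_iscale 2 mfnn2; push_cast at this; exact this)))
    push_cast at h
    have e : (2 : ℝ) * (M ^ 2 * (Rbar L Δ f + 2 * f (K1 L) ^ 2)) = 2 * M ^ 2 * (Rbar L Δ f + 2 * f (K1 L) ^ 2) := by ring
    rwa [e] at h
  have hQ0nn : 0 ≤ Q0 L f := Finset.sum_nonneg fun r _ => by positivity
  have hRwt : ∀ a, 0 ≤ Rwt L Δ f a := by
    intro a; unfold Rwt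
    by_cases h : a = 0 ∨ a = K1 L
    · rw [if_pos h]
    · rw [if_neg h]; exact sq_nonneg _
  have hRbnn : 0 ≤ Rbar L Δ f := Finset.sum_nonneg fun a _ => hRwt a
  have hXnn : 0 ≤ Xmom L Δ f := Finset.sum_nonneg fun a _ =>
    mul_nonneg (hRwt a) (sub_nonneg.mpr (Real.cos_le_one _))
  have hMnn : 0 ≤ M := le_trans (abs_nonneg _) (hMabs 0)
  have hGnn : 0 ≤ GammaM L Δ f M := by
    unfold GammaM
    exact mul_nonneg (mul_nonneg (by norm_num) (sq_nonneg _)) (add_nonneg hRbnn (mul_nonneg (by norm_num) (sq_nonneg _)))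
  have hrad : 0 ≤ 4 * Q0 L f * Xmom L Δ f * (GammaM L Δ f M * Rbar L Δ f) :=
    mul_nonneg (mul_nonneg (mul_nonneg (by norm_num) hQ0nn) hXnn) (mul_nonneg hGnn hRbnn)
  have mrad := mem_imul (mem_iscale 4 (mem_imul mQ0 mX)) (mem_imul mGam mRb)
  have msq : mem (Real.sqrt (4 * Q0 L f * Xmom L Δ f * (GammaM L Δ f M * Rbar L Δ f)))
      (isqrt (imul (iscale 4 (imul (xcQ0 L ft) (xcX L gx (cosTab L))))
        (imul (iscale 2 (imul (imul (ipt Mz) (ipt Mz)) (iadd (xcRbar L gx)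
          (iscale 2 (isqP (getF ft 1 0)))))) (xcRbar L gx)))) := by
    refine mem_isqrt (Real.sqrt_nonneg _) ?_
    rw [Real.sq_sqrt hrad]
    push_cast at mrad
    have e : ((4 : ℕ) : ℝ) * (Q0 L f * Xmom L Δ f) * (GammaM L Δ f M * Rbar L Δ f)
        = 4 * Q0 L f * Xmom L Δ f * (GammaM L Δ f M * Rbar L Δ f) := by push_cast; ring
    rw [← e]; exact_mod_cast mrad
  have hcs := cs2RealSpaceBound_holds L Δ lam2 M f hf.1 hmi hMabs
  have mChi := mem_iadd (mem_iadd (mem_iscale 4 (mem_imul (mem_imul meps mQ0) mX))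
    (mem_imul (mem_imul meps mRb) (mem_iadd mGam (mem_iscale 2 (mem_imul mfnn2 mM2)))))
    (mem_iscale 2 (mem_imul meps msq))
  have h1 := ShellRow.nC0p_le_nC0 L hf.1
  have h2 := ShellRow.nC0_split L Δ lam2 f
  have h3 := c0FreeBound_holds L Δ lam2 M f hf.1 hev hMabs
  have h4 := ShellRow.shell_reduction L Δ lam2 hev hsw
  have eSh : nC0shell L Δ lam2 f = ∑ c ∈ Finset.univ.filter (fun c : Cfg L => Wcount L c ≠ 0), C0fn L Δ lam2 f c ^ 2 := rfl
  rw [← eSh] at h2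
  have mN := mem_iadd (mem_idivn (mem_iscale 9 (mem_imul mM2 mPsi)) (by norm_num : (0:ℤ) < 4)) (mem_iscale 12 mRS)
  have hcs0 : 0 ≤ cs2 L f := by
    unfold cs2
    exact Finset.sum_nonneg fun c _ => by
      split_ifs
      · exact le_rfl
      · exact div_nonneg (add_nonneg (mul_nonneg (sq_nonneg _) (Complex.normSq_nonneg _))
          (mul_nonneg (sq_nonneg _) (Complex.normSq_nonneg _))) (by norm_num)
  have hn0 : 0 ≤ nC0p L Δ f := by unfold nC0p; exact Finset.sum_nonneg fun c _ => Complex.normSq_nonneg _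
  have hNle : nC0p L Δ f ≤ 9 / 4 * M ^ 2 * PsiSum L Δ f
      + 12 * ∑ b ∈ ((Finset.univ : Finset (Tor L)).erase 0).erase (ex L), C0fn L Δ lam2 f (ex L, b) ^ 2 := by
    linarith [h1, h2, h3, h4]
  refine ⟨_, _, hcs, hNle, hcs0.trans hcs, hn0.trans hNle, ?_, ?_, ?_⟩
  · have e : ((4 : ℕ) : ℝ) * (eps1 L * Q0 L f * Xmom L Δ f)
          + eps1 L * Rbar L Δ f * (GammaM L Δ f M + ((2 : ℕ) : ℝ) * (f (K1 L) ^ 2 * M ^ 2))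
          + ((2 : ℕ) : ℝ) * (eps1 L * Real.sqrt (4 * Q0 L f * Xmom L Δ f * (GammaM L Δ f M * Rbar L Δ f)))
        = 4 * eps1 L * Q0 L f * Xmom L Δ f + eps1 L * Rbar L Δ f * (GammaM L Δ f M + 2 * f (K1 L) ^ 2 * M ^ 2)
          + 2 * eps1 L * Real.sqrt (4 * Q0 L f * Xmom L Δ f * (GammaM L Δ f M * Rbar L Δ f)) := by push_cast; ring
    rw [e] at mChi
    unfold xcObjT
    exact mChi
  · have e : ((9 : ℕ) : ℝ) * (M ^ 2 * PsiSum L Δ f) / ((4 : ℤ) : ℝ)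
          + ((12 : ℕ) : ℝ) * ∑ b ∈ ((Finset.univ : Finset (Tor L)).erase 0).erase (ex L), C0fn L Δ lam2 f (ex L, b) ^ 2
        = 9 / 4 * M ^ 2 * PsiSum L Δ f
          + 12 * ∑ b ∈ ((Finset.univ : Finset (Tor L)).erase 0).erase (ex L), C0fn L Δ lam2 f (ex L, b) ^ 2 := by
      push_cast; ring
    rw [e] at mN
    unfold xcObjT
    exact mN
  · unfold xcObjT etaEff
    have hVl : mem ((L : ℝ) ^ 2 * lam2) (iscale (L * L) S.lam) := by
      have := mem_iscale (L * L) mlam; push_cast at this; rw [← sq] at this; exact this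
    have h := mem_idivn hVl (by norm_num : (0:ℤ) < 4)
    have e : (L : ℝ) ^ 2 * lam2 / ((4 : ℤ) : ℝ) = (L : ℝ) ^ 2 * lam2 / 4 := by push_cast; ring
    rwa [e] at h

end FinXB

end Summit.HubbardSuperconductivity.HubbardSuperconductivity.Theorems.AnisotropyChord.Transfer.Fibre3
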